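import Mathlib.Algebra.Module.Defs
import Mathlib.Algebra.Group.Action.Defs
import Mathlib.Tactic
import HarnessLib

/-!
# K1⁺ brick 2 — crossed homomorphisms against a central `−1`: Sah's identity and the `2`-torsion normal form

Crux U1 `KolyvaginBoundedDefectAtTwo` (stmt-BirchSwinnertonDyer-28083), LINE 17 `regular_core_rigidity`, support statement K1⁺
`PhantomLineAtTwo` (pen bsd-idea-1 g13, HOME `line17/PhantomLineAtTwo.lean`; memo `line17/K1_row_memo_g13.md` § v3 step (1)).
Width seat `bsd-line-krr2-p2` g17; `--supports stmt-BirchSwinnertonDyer-28083 --as helper`. PURE ALGEBRA (no curves): a group `Γ` acting on an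
additive commutative group `T`, bare crossed homomorphisms `ψ : Γ → T` (`ψ (g h) = ψ g + g • ψ h`) that vanish on the kernel of the action
(`ψ n = 0` whenever `n` acts trivially) — the shape of an INFLATED class — and an element `z ∈ Γ` acting as `−1` on `T`.

* `cocycle_apply_one`, `cocycle_apply_inv`, `cocycle_mul_right_of_trivial`, `cocycle_mul_left_of_trivial`, `coboundary_isCocycle`,
  `cocycle_conj_of_trivial` — bookkeeping;
* `two_zsmul_cocycle_eq` — **Sah's identity**: `2 • ψ g = ψ z − g • ψ z` for every `g` (so `2ψ` is a coboundary: the EXPONENT form, tree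
  `RegularWalk.two_zsmul_eq_zero_of_res_eq_zero`, is the case "`ψ` is a class");
* `smul_cocycle_apply_neg_sub_mem_two` — the residue of `ψ z` mod `2T` is `Γ`-invariant;
* `exists_shift_two_torsion_and_apply_neg_eq_zero` — **normal form**: if `(T/2T)^Γ = 0` (hypothesis `hV`, in element form), then after a
  coboundary shift `ψ + ∂b` the cocycle takes values in `T[2]` and vanishes at `z` — step (1) of the all-level proof of
  `|H¹(GL₂(ℤ/2^m), (ℤ/2^j)²)| ≤ 2` (the centre `⟨−I⟩` is removed: `H¹(G, A) ≅ H¹(G/±I, A[2])`-shaped statement at cocycle level).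
Nothing here proves K1⁺, S2, U1 or BSD. [cite: Sah1968, Prop. 2.7 (b)] [cite: LawsonWuthrich2016, §7.1 and Thm. 1]
-/

set_option autoImplicit false
-- the Theorems namespace of this sub repeats the summit name by design (D-0017 nested layout)
set_option linter.dupNamespace false

namespace Summit.BirchSwinnertonDyer.BirchSwinnertonDyer.Theorems.KolyvaginAtTwo.PhantomCore

variable {Γ : Type*} [Group Γ] {T : Type*} [AddCommGroup T] [DistribMulAction Γ T]

/-- A crossed homomorphism vanishes at `1`. [folklore] -/
theorem cocycle_apply_one {ψ : Γ → T} (hψ : ∀ g h, ψ (g * h) = ψ g + g • ψ h) : ψ 1 = 0 := by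
  have h := hψ 1 1
  rw [mul_one, one_smul] at h
  -- h : ψ 1 = ψ 1 + ψ 1
  have : ψ 1 + ψ 1 = ψ 1 + 0 := by rw [add_zero]; exact h.symm
  exact add_left_cancel this

/-- Value of a crossed homomorphism at an inverse. [folklore] -/
theorem cocycle_apply_inv {ψ : Γ → T} (hψ : ∀ g h, ψ (g * h) = ψ g + g • ψ h) (g : Γ) :
    ψ g⁻¹ = -(g⁻¹ • ψ g) := by
  have h := hψ g⁻¹ g
  rw [inv_mul_cancel, cocycle_apply_one hψ] at h
  -- h : 0 = ψ g⁻¹ + g⁻¹ • ψ g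
  exact eq_neg_of_add_eq_zero_left h.symm

/-- Right translation by an element acting trivially where `ψ` vanishes does not change the value. [folklore] -/
theorem cocycle_mul_right_of_trivial {ψ : Γ → T} (hψ : ∀ g h, ψ (g * h) = ψ g + g • ψ h)
    {n : Γ} (hψn : ψ n = 0) (g : Γ) : ψ (g * n) = ψ g := by
  rw [hψ, hψn, smul_zero, add_zero]

/-- Left translation by an element acting trivially on `T` where `ψ` vanishes does not change the value. [folklore] -/
theorem cocycle_mul_left_of_trivial {ψ : Γ → T} (hψ : ∀ g h, ψ (g * h) = ψ g + g • ψ h)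
    {n : Γ} (hn : ∀ t : T, n • t = t) (hψn : ψ n = 0) (g : Γ) : ψ (n * g) = ψ g := by
  rw [hψ, hψn, hn, zero_add]

/-- A crossed homomorphism that vanishes on the kernel of the action is constant on its cosets: if `g` and `g'` act identically on `T`
then `ψ g = ψ g'`. [folklore] -/
theorem cocycle_eq_of_smul_eq {ψ : Γ → T} (hψ : ∀ g h, ψ (g * h) = ψ g + g • ψ h)
    (hN : ∀ n : Γ, (∀ t : T, n • t = t) → ψ n = 0) {g g' : Γ} (hgg' : ∀ t : T, g • t = g' • t) :
    ψ g = ψ g' := by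
  have hn : ∀ t : T, (g'⁻¹ * g) • t = t := fun t ↦ by
    rw [mul_smul, hgg', inv_smul_smul]
  have : g = g' * (g'⁻¹ * g) := by group
  rw [this, cocycle_mul_right_of_trivial hψ (hN _ hn)]

/-- A coboundary `g ↦ g • b − b` is a crossed homomorphism. [folklore] -/
theorem coboundary_isCocycle (b : T) (g h : Γ) :
    (g * h) • b - b = (g • b - b) + g • (h • b - b) := by
  rw [mul_smul, smul_sub]; abel

/-- A coboundary vanishes on elements acting trivially. [folklore] -/
theorem coboundary_apply_of_trivial (b : T) {n : Γ} (hn : ∀ t : T, n • t = t) : n • b - b = 0 := by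
  rw [hn, sub_self]

/-- The sum of a crossed homomorphism and a coboundary is a crossed homomorphism. [folklore] -/
theorem cocycle_add_coboundary {ψ : Γ → T} (hψ : ∀ g h, ψ (g * h) = ψ g + g • ψ h) (b : T)
    (g h : Γ) : (ψ (g * h) + ((g * h) • b - b)) = (ψ g + (g • b - b)) + g • (ψ h + (h • b - b)) := by
  rw [hψ, coboundary_isCocycle, smul_add]; abel

/-- The difference of two crossed homomorphisms is a crossed homomorphism. [folklore] -/
theorem cocycle_sub {ψ₁ ψ₂ : Γ → T} (hψ₁ : ∀ g h, ψ₁ (g * h) = ψ₁ g + g • ψ₁ h)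
    (hψ₂ : ∀ g h, ψ₂ (g * h) = ψ₂ g + g • ψ₂ h) (g h : Γ) :
    (ψ₁ (g * h) - ψ₂ (g * h)) = (ψ₁ g - ψ₂ g) + g • (ψ₁ h - ψ₂ h) := by
  rw [hψ₁, hψ₂, smul_sub]; abel

/-- **Equivariance on a trivially-acting element**: if `γ` acts trivially on `T` ⊇ the values, then `ψ (g γ g⁻¹) = g • ψ γ`
(for a cocycle whose value `ψ γ` is fixed by `γ`... in fact for any `γ` with `γ • ψ g⁻¹ = ψ g⁻¹`). Here in the form needed later:
`γ` fixes the value `ψ (g⁻¹)`. [folklore] -/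
theorem cocycle_conj_of_fix {ψ : Γ → T} (hψ : ∀ g h, ψ (g * h) = ψ g + g • ψ h) (g γ : Γ)
    (hfix : γ • ψ g⁻¹ = ψ g⁻¹) : ψ (g * γ * g⁻¹) = g • ψ γ := by
  rw [hψ, hψ, mul_smul, hfix, cocycle_apply_inv hψ g, smul_neg, smul_inv_smul]
  abel

/-! ### The central `−1` -/

/-- **Sah's identity.** If `z` acts as `−1` on `T` and the crossed homomorphism `ψ` vanishes on the kernel of the action, then
`2 • ψ g = ψ z − g • ψ z` for every `g` (compare `ψ (g z) = ψ (z g)`: the commutator acts trivially). [cite: Sah1968, Prop. 2.7 (b)] -/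
theorem two_zsmul_cocycle_eq {ψ : Γ → T} (hψ : ∀ g h, ψ (g * h) = ψ g + g • ψ h)
    (hN : ∀ n : Γ, (∀ t : T, n • t = t) → ψ n = 0) {z : Γ} (hz : ∀ t : T, z • t = -t) (g : Γ) :
    (2 : ℤ) • ψ g = ψ z - g • ψ z := by
  have hcomm : ψ (g * z) = ψ (z * g) :=
    cocycle_eq_of_smul_eq hψ hN fun t ↦ by rw [mul_smul, mul_smul, hz, hz, smul_neg]
  rw [hψ, hψ, hz] at hcomm
  -- hcomm : ψ g + g • ψ z = ψ z + -ψ g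
  rw [two_zsmul]
  calc ψ g + ψ g = ψ g + g • ψ z + ψ g - g • ψ z := by abel
    _ = ψ z + -ψ g + ψ g - g • ψ z := by rw [hcomm]
    _ = ψ z - g • ψ z := by abel

/-- The residue of `ψ z` modulo `2T` is `Γ`-invariant: `g • ψ z − ψ z = 2 • (−ψ g)`. [cite: Sah1968, Prop. 2.7 (b)] -/
theorem smul_cocycle_apply_neg_sub {ψ : Γ → T} (hψ : ∀ g h, ψ (g * h) = ψ g + g • ψ h)
    (hN : ∀ n : Γ, (∀ t : T, n • t = t) → ψ n = 0) {z : Γ} (hz : ∀ t : T, z • t = -t) (g : Γ) :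
    g • ψ z - ψ z = (2 : ℤ) • (-ψ g) := by
  rw [smul_neg, two_zsmul_cocycle_eq hψ hN hz g]; abel

/-- **Normal form modulo coboundaries (step (1)).** Suppose `z` acts as `−1`, `ψ` vanishes on the kernel of the action, and
`(T/2T)^Γ = 0` in element form (`hV`: an element whose every `g • a − a` is divisible by `2` is itself divisible by `2`). Then for some
`b : T` the shifted cocycle `ψ + ∂b`, `∂b g = g • b − b`, takes values in `T[2]` and VANISHES at `z`.
[cite: LawsonWuthrich2016, §7.1] [cite: Sah1968, Prop. 2.7 (b)] -/
theorem exists_shift_two_torsion_and_apply_neg_eq_zero {ψ : Γ → T} (hψ : ∀ g h, ψ (g * h) = ψ g + g • ψ h)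
    (hN : ∀ n : Γ, (∀ t : T, n • t = t) → ψ n = 0) {z : Γ} (hz : ∀ t : T, z • t = -t)
    (hV : ∀ a : T, (∀ g : Γ, ∃ c : T, g • a - a = (2 : ℤ) • c) → ∃ b : T, a = (2 : ℤ) • b) :
    ∃ b : T, (∀ g, (2 : ℤ) • (ψ g + (g • b - b)) = 0) ∧ ψ z + (z • b - b) = 0 := by
  obtain ⟨b, hb⟩ := hV (ψ z) fun g ↦ ⟨-ψ g, smul_cocycle_apply_neg_sub hψ hN hz g⟩
  refine ⟨b, fun g ↦ ?_, ?_⟩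
  · rw [smul_add, two_zsmul_cocycle_eq hψ hN hz g, hb, ← smul_comm (2 : ℤ) g b, smul_sub]
    abel
  · rw [hb, hz]; abel

/-- After the shift the new function is again a crossed homomorphism vanishing on the kernel of the action (bookkeeping for step (1)).
[folklore] -/
theorem shift_isCocycle_and_vanishes {ψ : Γ → T} (hψ : ∀ g h, ψ (g * h) = ψ g + g • ψ h)
    (hN : ∀ n : Γ, (∀ t : T, n • t = t) → ψ n = 0) (b : T) :
    (∀ g h, (ψ (g * h) + ((g * h) • b - b)) = (ψ g + (g • b - b)) + g • (ψ h + (h • b - b))) ∧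
      ∀ n : Γ, (∀ t : T, n • t = t) → ψ n + (n • b - b) = 0 :=
  ⟨cocycle_add_coboundary hψ b, fun n hn ↦ by rw [hN n hn, coboundary_apply_of_trivial b hn, add_zero]⟩

end Summit.BirchSwinnertonDyer.BirchSwinnertonDyer.Theorems.KolyvaginAtTwo.PhantomCore
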